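import Literature.AlgebraicGeometry.Frobenioids.DivisorTransport
import Literature.AlgebraicGeometry.Frobenioids.MonoprimeEquivMul
import HarnessLib

/-!
# Frobenioids I, Theorem 4.2 (iii): the LEFT-HAND isomorphism `Φ₁(A)_𝔭 ≅ Φ₂(Ψ A)_{𝔭'}` induced by `Ψ`
# on the divisors of pre-steps INTO a Div-Frobenius-trivial object

Mochizuki, *The geometry of Frobenioids I: the general theory*, Kyushu J. Math. **62** (2008)
293–400, §4, Theorem 4.2 (iii), statement p. 78, proof p. 81 [cite: MochizukiFrdI2008, Thm. 4.2 (iii) p.78]: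
"If … the `A_i` are Div-Frobenius-trivial, then the [equivalences `Order(Φ₁(A₁)_𝔭₁)^opp ≅
Order(Φ₂(A₂)_𝔭₂)^opp` of (ii)] arise from isomorphisms of monoids `Φ₁(A₁)_𝔭₁ ≅ Φ₂(A₂)_𝔭₂` … the
left-hand isomorphism"; proof: "by considering commutative diagrams [`B_i → A_i` over `B_i' → A_i`] —
where the vertical morphisms are morphisms of Frobenius type [cf. Proposition 1.10, (i)], the morphisms
`A_i → A_i` are Div-identity endomorphisms, and the horizontal morphisms are primary steps — it follows
that the equivalences of categories in question arise from bijections of sets … compatible both with `≤`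
and with multiplication by elements of `ℕ≥1`. In light of the well-known structure of the monoids `ℚ≥0`,
`ℝ≥0` …, this is enough to conclude that these bijections of sets are, in fact, isomorphisms of monoids."

PROVED here in the tree's vocabulary (found's Def 1.3 API), for Frobenioids `C_i → F_{Φ_i}` of isotropic
type with `Φ_i` perf-factorial, an equivalence `Ψ` with `Ψ`, `Ψ⁻¹` preserving pre-steps, `Ψ` preserving
morphisms of Frobenius type, Frobenius degrees and Div-identity endomorphisms of `A` [conclusions of
Thm. 3.4 (ii), (iii) and Thm. 4.2 (i), HYPOTHESES], a Div-Frobenius-trivial `A`, a prime `𝔭` of `Φ₁(A)`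
and a prime `𝔭'` of `Φ₂(Ψ A)` that "correspond" in the sense of clause (b) of the typed `Thm42ii`
[HYPOTHESIS `he`]: there is an isomorphism of monoids `l : Φ₁(A)_𝔭 ≃* Φ₂(Ψ A)_{𝔭'}` with
`(Ψψ)_*Div(Ψψ) = l(ψ_*Div ψ)` for every co-angular pre-step `ψ` into `A` with `ψ_*Div ψ ∈ Φ₁(A)_𝔭`
(`exists_leftIso`). Ingredients: the divisor of a pre-step conjugated through a Div-identity Frobenius
endomorphism is the `deg`-th power (`invDiv_eq_pow_of_square`, the square of p. 81 via Prop. 1.7 (ii)),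
order/equality transport (`DivisorTransport.lean`) and the monoid kernel
`IsMonoprime.nonempty_mulEquiv_of_dvd_iff_of_pow` (`MonoprimeEquivMul.lean`, seat abc-iut-L1-d10).
Composition is diagrammatic; monoids multiplicative (`Φ_𝔭 = Primes.submonoid 𝔭`). No new definitions.
-/

namespace Literature.AlgebraicGeometry.Frobenioids

open CategoryTheory Opposite

section Monoid

universe w
variable {M : Type w} [CommMonoid M]

/-- Divisibility inside `Φ_𝔭 = 𝔭 ∪ {0}` is divisibility in `Φ` (`Φ_𝔭` is divisor-closed, §0 p. 12).
[cite: MochizukiFrdI2008, §0 p.12] -/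
theorem Primes.subtype_dvd_iff (𝔭 : Primes M) (a b : 𝔭.submonoid) : a ∣ b ↔ (a : M) ∣ (b : M) := by
  constructor
  · rintro ⟨c, rfl⟩
    exact ⟨c, rfl⟩
  · rintro ⟨c, hc⟩
    have hcm : c ∈ 𝔭.submonoid := 𝔭.mem_submonoid_of_dvd (Dvd.intro_left _ hc.symm) b.2
    exact ⟨⟨c, hcm⟩, Subtype.ext hc⟩

end Monoid

namespace PreFrobenioid

universe w v v' u u' w₂ v₂ v₂' u₂ u₂'

variable {D : Type u} [Category.{v} D] {Φ : Dᵒᵖ ⥤ CommMonCat.{w}}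
  {C : Type u'} [Category.{v'} C] {F : C ⥤ ElemFrobenioid Φ}

/-- **The square of p. 81, slice version**: for a pre-step `ψ : B → A`, a Div-identity isometry
`α : A → A` (e.g. a Div-identity endomorphism of Frobenius type), an isometry `β : B → B'` and a pre-step
`ψ' : B' → A` with `α ∘ ψ = ψ' ∘ β`, one has `ψ'_*Div(ψ') = deg_Fr(α) · ψ_*Div(ψ)` in `Φ(A)`.
[cite: MochizukiFrdI2008, Thm. 4.2 (iii) p.81] -/
theorem invDiv_eq_pow_of_square {B A B' : C} {ψ : B ⟶ A} {α : A ⟶ A} {β : B ⟶ B'} {ψ' : B' ⟶ A}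
    (hψ : IsPreStep F ψ) (hαd : IsDivIdentity F α) (hαi : IsIsometry F α) (hβ : IsIsometry F β)
    (hψ' : IsPreStep F ψ') (hsq : ψ ≫ α = β ≫ ψ') (h : IsBaseIso F (ψ ≫ α)) :
    invDiv F ψ' hψ'.2 = invDiv F ψ hψ.2 ^ (degFr F α : ℕ) := by
  haveI : IsIso (Base F (ψ ≫ α)) := h
  haveI : IsIso (Base F ψ) := hψ.2
  apply pull_injective_of_isIso Φ (Base F (ψ ≫ α))
  have h1 : pull Φ (Base F (ψ ≫ α)) (invDiv F ψ' hψ'.2) = Div F (β ≫ ψ') := by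
    rw [hsq, base_comp, pull_comp, pull_invDiv, div_comp, show Div F β = 1 from hβ, one_pow, mul_one]
  have h2 : pull Φ (Base F (ψ ≫ α)) (invDiv F ψ hψ.2 ^ (degFr F α : ℕ)) = Div F (ψ ≫ α) := by
    rw [base_comp, pull_comp, show pull Φ (Base F α) (invDiv F ψ hψ.2 ^ (degFr F α : ℕ)) =
      invDiv F ψ hψ.2 ^ (degFr F α : ℕ) from by rw [hαd]; rfl, map_pow, pull_invDiv, div_comp,
      show Div F α = 1 from hαi, map_one, one_mul]
  rw [h1, h2, hsq]

/-- **The square of p. 81, coslice version**: for a pre-step `φ : A → B`, a Div-identity isometry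
`α : A → A`, an isometry `β : B → B'` and `φ' : A → B'` with `φ' ∘ α = β ∘ φ`, one has
`Div(φ') = deg_Fr(β) · Div(φ)` in `Φ(A)`. [cite: MochizukiFrdI2008, Thm. 4.2 (iii) p.81] -/
theorem div_eq_pow_of_square {A B B' : C} {φ : A ⟶ B} {α : A ⟶ A} {β : B ⟶ B'} {φ' : A ⟶ B'}
    (hαd : IsDivIdentity F α) (hαi : IsIsometry F α) (hβ : IsIsometry F β)
    (hsq : α ≫ φ' = φ ≫ β) : Div F φ' = Div F φ ^ (degFr F β : ℕ) := by
  have h1 : Div F (α ≫ φ') = Div F φ' := by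
    rw [div_comp, show pull Φ (Base F α) (Div F φ') = Div F φ' from by rw [hαd]; rfl,
      show Div F α = 1 from hαi, one_pow, mul_one]
  rw [← h1, hsq, div_comp, show Div F β = 1 from hβ, map_one, one_mul]

variable {D₂ : Type u₂} [Category.{v₂} D₂] {Φ₂ : D₂ᵒᵖ ⥤ CommMonCat.{w₂}}
  {C₂ : Type u₂'} [Category.{v₂'} C₂] {F₂ : C₂ ⥤ ElemFrobenioid Φ₂} (Ψ : C ≌ C₂)

set_option backward.isDefEq.respectTransparency false in
/-- **Theorem 4.2 (iii), the left-hand isomorphism** (FrdI p. 78, proof p. 81): for Frobenioids of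
isotropic type with perf-factorial divisor monoids, an equivalence `Ψ` with `Ψ`, `Ψ⁻¹` preserving
pre-steps and `Ψ` preserving morphisms of Frobenius type, Frobenius degrees and the Div-identity
endomorphisms of `A` [Thm. 3.4 (ii)(iii), Thm. 4.2 (i) — hypotheses], a Div-Frobenius-trivial object `A`,
and primes `𝔭` of `Φ₁(A)`, `𝔭'` of `Φ₂(Ψ A)` corresponding as in Thm. 4.2 (ii) (b) [hypothesis `he`]:
there is an ISOMORPHISM OF MONOIDS `l : Φ₁(A)_𝔭 ≃* Φ₂(Ψ A)_{𝔭'}` such that for every co-angular pre-step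
`ψ : B → A` with `ψ_*Div(ψ) = y ∈ Φ₁(A)_𝔭`, `(Ψψ)_*Div(Ψψ) = l(y)` (both through `Base(−)^*`, as typed).
[cite: MochizukiFrdI2008, Thm. 4.2 (iii) p.78] -/
theorem exists_leftIso (hF : IsFrobenioid F) (hF₂ : IsFrobenioid F₂)
    (histr : IsOfIsotropicType F) (histr₂ : IsOfIsotropicType F₂)
    (hpf : Objectwise (fun M _ => IsPerfFactorial M) Φ)
    (hpf₂ : Objectwise (fun M _ => IsPerfFactorial M) Φ₂)
    (hpre : ∀ ⦃X Y : C⦄ (φ : X ⟶ Y), IsPreStep F φ → IsPreStep F₂ (Ψ.functor.map φ))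
    (hpre' : ∀ ⦃X Y : C₂⦄ (φ : X ⟶ Y), IsPreStep F₂ φ → IsPreStep F (Ψ.inverse.map φ))
    (hfrob : ∀ ⦃X Y : C⦄ (φ : X ⟶ Y), IsFrobeniusType F φ → IsFrobeniusType F₂ (Ψ.functor.map φ))
    (hdeg : ∀ ⦃X Y : C⦄ (φ : X ⟶ Y), degFr F₂ (Ψ.functor.map φ) = degFr F φ)
    {A : C} (hA : IsDivFrobeniusTrivial F A)
    (hdivid : ∀ α : A ⟶ A, IsDivIdentity F α → IsDivIdentity F₂ (Ψ.functor.map α))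
    (𝔭 : Primes (Φ.obj (op (baseObj F A)))) (𝔭' : Primes (Φ₂.obj (op (baseObj F₂ (Ψ.functor.obj A)))))
    (he : ∀ ⦃B : C⦄ (ψ : B ⟶ A), IsCoAngularPreStep F ψ →
      ((∃ y ∈ 𝔭.submonoid, pull Φ (Base F ψ) y = Div F ψ) ↔
        ∃ y ∈ 𝔭'.submonoid, pull Φ₂ (Base F₂ (Ψ.functor.map ψ)) y = Div F₂ (Ψ.functor.map ψ))) :
    ∃ l : 𝔭.submonoid ≃* 𝔭'.submonoid, ∀ ⦃B : C⦄ (ψ : B ⟶ A), IsCoAngularPreStep F ψ →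
      ∀ (y : Φ.obj (op (baseObj F A))) (h : y ∈ 𝔭.submonoid), pull Φ (Base F ψ) y = Div F ψ →
        pull Φ₂ (Base F₂ (Ψ.functor.map ψ)) (l ⟨y, h⟩ : Φ₂.obj (op (baseObj F₂ (Ψ.functor.obj A)))) =
          Div F₂ (Ψ.functor.map ψ) := by
  have hP := hF.isPreFrobenioid
  have hP₂ := hF₂.isPreFrobenioid
  have hco : ∀ {X Y : C} (f : X ⟶ Y), IsCoAngular F f :=
    fun f => isCoAngular_of_isIsotropic_codomains F f fun Z _ => histr Z
  -- a co-angular pre-step `ψ_y : B_y → A` with `(ψ_y)_* Div ψ_y = y`, for every `y ∈ Φ₁(A)`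
  choose Bo ψo hψo hψox using fun y : Φ.obj (op (baseObj F A)) => hF.iii_d_over_surj A y
  have hΨψo : ∀ y, IsPreStep F₂ (Ψ.functor.map (ψo y)) := fun y => hpre _ (hψo y).2
  -- the candidate map on elements: `y ↦ (Ψψ_y)_* Div(Ψψ_y)`
  have hmem : ∀ y : 𝔭.submonoid, invDiv F₂ (Ψ.functor.map (ψo y)) (hΨψo y).2 ∈ 𝔭'.submonoid := by
    intro y
    haveI : IsIso (Base F₂ (Ψ.functor.map (ψo y))) := (hΨψo y).2
    have hw : pull Φ (Base F (ψo y)) (y : Φ.obj (op (baseObj F A))) = Div F (ψo y) := by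
      have h := pull_invDiv (ψo (y : Φ.obj (op (baseObj F A)))) (hψo y).2.2
      rwa [hψox] at h
    obtain ⟨y₂, hy₂, e₂⟩ := (he (ψo y) (hψo y)).mp ⟨y, y.2, hw⟩
    have hy₂' : y₂ = invDiv F₂ (Ψ.functor.map (ψo y)) (hΨψo y).2 :=
      pull_injective_of_isIso Φ₂ (Base F₂ (Ψ.functor.map (ψo y))) (by rw [e₂, pull_invDiv])
    rwa [hy₂'] at hy₂
  let f : 𝔭.submonoid → 𝔭'.submonoid := fun y => ⟨_, hmem y⟩
  -- key: `f` computes `(Ψψ)_* Div(Ψψ)` for EVERY pre-step `ψ` into `A` with `ψ_* Div ψ = y`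
  have hkey : ∀ (y : 𝔭.submonoid) ⦃B : C⦄ (ψ : B ⟶ A) (hψ : IsPreStep F ψ),
      invDiv F ψ hψ.2 = y → (f y : Φ₂.obj (op (baseObj F₂ (Ψ.functor.obj A)))) =
        invDiv F₂ (Ψ.functor.map ψ) (hpre ψ hψ).2 := by
    intro y B ψ hψ hx
    exact (invDiv_eq_iff_map Ψ hF hF₂ histr histr₂ hpre hpre' hψ (hψo y).2).mp ((hψox y).trans hx.symm)
  -- compatible with `≤`
  have hdvd : ∀ x y : 𝔭.submonoid, x ∣ y ↔ f x ∣ f y := by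
    intro x y
    rw [Primes.subtype_dvd_iff, Primes.subtype_dvd_iff, ← hψox x, ← hψox y]
    exact invDiv_dvd_iff_map Ψ hF hF₂ histr histr₂ hpre hpre' (hψo y).2 (hψo x).2
  -- compatible with `ℕ≥1`: the square through a Div-identity Frobenius endomorphism of `A`
  obtain ⟨ζ, hζ⟩ := hA
  have hζ' : ∀ n : ℕ+, ∃ α : A ⟶ A, degFr F α = n ∧ IsDivIdentity F α ∧ IsFrobeniusType F α :=
    fun n => ⟨ζ n, hζ n⟩
  have hpow : ∀ (y : 𝔭.submonoid) (n : ℕ+), f (y ^ (n : ℕ)) = f y ^ (n : ℕ) := by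
    intro y n
    obtain ⟨α, hdegα, hαd, hαf⟩ := hζ' n
    have hbi : IsBaseIso F (ψo y ≫ α) := IsBaseIso.comp F (hψo y).2.2 hαf.2
    obtain ⟨X, β, ψ', hfac, hβ, hψ'⟩ := (isBaseIso_iff_exists_frobeniusType_preStep F hF (ψo y ≫ α)).mp hbi
    -- in `C₁`: `x_{ψ'} = y ^ n`
    have hx' : invDiv F ψ' hψ'.2 = (y : Φ.obj (op (baseObj F A))) ^ (n : ℕ) := by
      rw [invDiv_eq_pow_of_square (hψo y).2 hαd hαf.1.2 hβ.1.2 hψ' hfac.symm hbi, hψox, hdegα]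
    -- in `C₂`: the image square gives `x_{Ψψ'} = x_{Ψψ_y} ^ n`
    have hsq₂ : Ψ.functor.map (ψo y) ≫ Ψ.functor.map α = Ψ.functor.map β ≫ Ψ.functor.map ψ' := by
      rw [← Functor.map_comp, ← hfac, Functor.map_comp]
    have hbi₂ : IsBaseIso F₂ (Ψ.functor.map (ψo y) ≫ Ψ.functor.map α) :=
      IsBaseIso.comp F₂ (hΨψo y).2 (hfrob _ hαf).2
    have hx₂ := invDiv_eq_pow_of_square (F := F₂) (hΨψo y) (hdivid _ hαd) (hfrob _ hαf).1.2
      (hfrob _ hβ).1.2 (hpre ψ' hψ') hsq₂ hbi₂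
    rw [hdeg, hdegα] at hx₂
    apply Subtype.ext
    rw [hkey (y ^ (n : ℕ)) ψ' hψ' hx', hx₂]
    rfl
  -- bijective
  have hinj : Function.Injective f := by
    intro x y hxy
    have h1 : invDiv F₂ (Ψ.functor.map (ψo x)) (hΨψo x).2 = invDiv F₂ (Ψ.functor.map (ψo y)) (hΨψo y).2 :=
      congrArg Subtype.val hxy
    have h2 := (invDiv_eq_iff_map Ψ hF hF₂ histr histr₂ hpre hpre' (hψo y).2 (hψo x).2).mpr h1
    exact Subtype.ext (by rw [← hψox x, ← hψox y, h2])
  have hsurj : Function.Surjective f := by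
    intro z
    obtain ⟨Z, ξ, hξ, hξx⟩ := hF₂.iii_d_over_surj (Ψ.functor.obj A) z.1
    -- transport `ξ` back to a pre-step `ξ₁` into `A`
    set ξ₁ : Ψ.inverse.obj Z ⟶ A := Ψ.inverse.map ξ ≫ Ψ.unitInv.app A with hξ₁def
    have hξ₁ : IsPreStep F ξ₁ := IsPreStep.comp F (hpre' ξ hξ.2) (isPreStep_of_isIso F _)
    have hΨξ₁ : IsPreStep F₂ (Ψ.functor.map ξ₁) := hpre _ hξ₁
    have e1 : Ψ.functor.map ξ₁ = Ψ.counit.app Z ≫ ξ := by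
      rw [hξ₁def, Functor.map_comp, Ψ.fun_inv_map, Category.assoc, Category.assoc,
        Ψ.counitInv_functor_comp, Category.comp_id]
    have hb' : IsBaseIso F₂ (Ψ.counit.app Z ≫ ξ) := e1 ▸ hΨξ₁.2
    have hx₁ : invDiv F₂ (Ψ.functor.map ξ₁) hΨξ₁.2 = z.1 := by
      rw [show invDiv F₂ (Ψ.functor.map ξ₁) hΨξ₁.2 = invDiv F₂ (Ψ.counit.app Z ≫ ξ) hb' from by congr 1,
        invDiv_iso_comp hP₂ _ _ hξ.2.2 hb', hξx]
    -- its divisor lies in `Φ₁(A)_𝔭` by (b) backwards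
    haveI : IsIso (Base F₂ (Ψ.functor.map ξ₁)) := hΨξ₁.2
    haveI : IsIso (Base F ξ₁) := hξ₁.2
    obtain ⟨y, hy, hyx⟩ := (he ξ₁ ⟨hco _, hξ₁⟩).mpr ⟨z.1, z.2, by rw [← hx₁, pull_invDiv]⟩
    have hy' : y = invDiv F ξ₁ hξ₁.2 := pull_injective_of_isIso Φ (Base F ξ₁) (by rw [hyx, pull_invDiv])
    refine ⟨⟨y, hy⟩, Subtype.ext ?_⟩
    rw [hkey ⟨y, hy⟩ ξ₁ hξ₁ hy'.symm, hx₁]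
  -- the monoid kernel (seat abc-iut-L1-d10)
  obtain ⟨l, hl⟩ := IsMonoprime.nonempty_mulEquiv_of_dvd_iff_of_pow ((hpf _).isMonoprime 𝔭)
    ((hpf₂ _).isMonoprime 𝔭') (Equiv.ofBijective f ⟨hinj, hsurj⟩) hdvd hpow
  refine ⟨l, fun B ψ hψ y h hyx => ?_⟩
  haveI : IsIso (Base F ψ) := hψ.2.2
  haveI : IsIso (Base F₂ (Ψ.functor.map ψ)) := (hpre ψ hψ.2).2
  have hy' : invDiv F ψ hψ.2.2 = y := (pull_injective_of_isIso Φ (Base F ψ) (by rw [hyx, pull_invDiv])).symm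
  rw [hl, Equiv.ofBijective_apply, hkey ⟨y, h⟩ ψ hψ.2 hy', pull_invDiv]

end PreFrobenioid

end Literature.AlgebraicGeometry.Frobenioids
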